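import Summits.HodgeConjecture.HodgeConjecture.Theses.GenericDivisibility
import Summits.HodgeConjecture.HodgeConjecture.Theorems.GenericDivisibilityHodgeClassesGenericallyDivisible
import Summits.HodgeConjecture.HodgeConjecture.Theorems.GenericDivisibilityGenericDivisibilityBoundedThomH3TorsionFree
import Summits.HodgeConjecture.HodgeConjecture.Theorems.GenericDivisibilityGenericDivisibilityBoundedSurfaceSaturation
import Literature.AlgebraicGeometry.Motives.BettiCycleClassFiniteProofs
import Literature.AlgebraicGeometry.Motives.VarietiesGeometricallyIntegralProofs
import HarnessLib

/-!
# The `ℓ`-adic funnel of line `finite-level-bootstrap` and the crux `GenericDivisibilityBounded`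
# at `p = 1` (crux C2, stmt-HodgeConjecture-18467, route `GenericDivisibility`)

Sorry-free, definition-free record of the PROVED part of the line `finite-level-bootstrap`
(crux workfile `Cruxes/GenericDivisibilityBounded/Lines/finite_level_bootstrap.lean`), importable by
other Theorems files. `X` is smooth projective over `ℂ`, `H = H^k(X(ℂ); ℤ)`, `z| = z|_{(X∖Z)(ℂ)}`
the restriction to the complex points of a Zariski open, and (spelled out inline, no definitions):

* "`x` is GENERICALLY TORSION" (`x ∈ GT`): `∃ Z` closed `≠ univ`, `∃ N ≥ 1`, `N • x| = 0`;
* "`D'(m, z)`": `∃ Z` closed `≠ univ`, `∃ y`, `∃ M ≥ 1`, `M • (z| - m • y) = 0`;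
* "level `ℓ^s` is CLEAN at `(p, X)`": `∀ z, D'(ℓ^s, z) → ∃ w, z - ℓ • w ∈ GT`.

## Main results

* `genericDivisibilityBounded_bootstrap` — a clean level `s` propagates up the `ℓ`-adic tower:
  `D'(ℓ^{n+s}, z) ⇒ ∃ w, z - ℓ^{n+1} • w ∈ GT` (pure algebra + directedness of non-empty opens).
* `genericDivisibilityBounded_krull`, `…_genericallyTorsion_of_forall_pow` — a saturated subgroup of
  a finitely generated abelian group is `ℓ`-adically closed; instance `GT ⊆ H`.
* `genericDivisibilityBounded_ringChange_mem_supportedClasses` — the bridge `GT ⊗ ℂ ⊆ N¹`.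
* `genericDivisibilityBounded_at_of_levelClean` — **C2 at `X` in degree `k` from ONE clean level.**
* `genericDivisibilityBounded_levelClean_surface`, `genericDivisibilityBounded_one` (= registered
  sub-goal `stub_cruxAtOne`) — on a smooth projective SURFACE every prime is clean at level one
  (landed p145990 + p146835), hence **the crux C2 at `p = 1`** (CT–Voisin 2012 §4.1), Hodge-free.

References: [ColliotTheleneVoisin2012] §3.1, §4.1; [HatcherAT2002] §3.1; [VoisinHodgeI2002] §11.3. -/

set_option linter.dupNamespace false

noncomputable section

namespace Summit.HodgeConjecture.HodgeConjecture.Theorems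

open CategoryTheory AlgebraicGeometry
open Literature.AlgebraicGeometry.Motives Literature.AlgebraicGeometry.HodgeTheory
  Literature.AlgebraicTopology.SingularHomology
open Summit.HodgeConjecture.HodgeConjecture.Theses.GenericDivisibility

/-- Restriction `H^k(X(ℂ);ℤ) → H^k((X∖Z)(ℂ);ℤ)`, the very term of the route decls (notation only). -/
local notation3 (prettyPrint := false) "Res[" X ", " Z ", " k "]" =>
  singularCohomology.map ℤ ℤ
    (⟨Subtype.val, continuous_subtype_val⟩ : C(complexPointsCompl X Z, ComplexPoints X)) k

/-- The inclusion `(X ∖ Z')(ℂ) ↪ (X ∖ Z)(ℂ)` for `h : Z ⊆ Z'`, spelled as in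
`genericDivisibility_restrict_restrict` (notation only). -/
local notation3 (prettyPrint := false) "Incl[" X ", " Z ", " Z' ", " h "]" =>
  (⟨fun P : complexPointsCompl X Z' => (⟨P.1, fun hP : P.1.pt ∈ Z => P.2 (h hP)⟩ :
      complexPointsCompl X Z),
    continuous_subtype_val.subtype_mk fun (P : complexPointsCompl X Z') (hP : P.1.pt ∈ Z) =>
      P.2 (h hP)⟩ : C(complexPointsCompl X Z', complexPointsCompl X Z))

/-! ### Directedness of the non-empty Zariski opens -/

/-- In an irreducible scheme two proper Zariski-closed subsets have proper union. [folklore] -/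
theorem genericDivisibilityBounded_union_ne_univ {X : SchemeOver ℂ} [IrreducibleSpace X.left]
    {Z₁ Z₂ : Set X.left} (hZ₁ : IsClosed Z₁) (hZ₂ : IsClosed Z₂) (h₁ : Z₁ ≠ Set.univ)
    (h₂ : Z₂ ≠ Set.univ) : Z₁ ∪ Z₂ ≠ Set.univ := by
  intro h
  rcases isPreirreducible_iff_isClosed_union_isClosed.mp
      (PreirreducibleSpace.isPreirreducible_univ (X := X.left)) Z₁ Z₂ hZ₁ hZ₂ h.symm.subset
      with h' | h'
  · exact h₁ (Set.eq_univ_of_univ_subset h')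
  · exact h₂ (Set.eq_univ_of_univ_subset h')

/-- A relation `N • x| = 0` on `(X ∖ Z)(ℂ)` persists on `(X ∖ Z')(ℂ)` for `Z ⊆ Z'`
(functoriality of restriction, Hatcher §3.1). [cite: HatcherAT2002, §3.1] -/
theorem genericDivisibilityBounded_nsmul_restrict_mono {X : SchemeOver ℂ} {Z Z' : Set X.left}
    (h : Z ⊆ Z') {k N : ℕ} {x : singularCohomology ℤ ℤ (ComplexPoints X) k}
    (hx : N • Res[X, Z, k] x = 0) : N • Res[X, Z', k] x = 0 := by
  have h' := congrArg (singularCohomology.map ℤ ℤ Incl[X, Z, Z', h] k) hx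
  rw [map_zero, map_nsmul] at h'
  change N • singularCohomology.map ℤ ℤ _ k (singularCohomology.map ℤ ℤ _ k x) = 0 at h'
  rwa [genericDivisibility_restrict_restrict ℤ h] at h'

/-! ### `GT` is a saturated subgroup -/

/-- `GT` is closed under addition (intersect the two opens; `X` irreducible). [folklore] -/
theorem genericDivisibilityBounded_genericallyTorsion_add {X : SchemeOver ℂ} [IrreducibleSpace X.left]
    {k : ℕ} {a b : singularCohomology ℤ ℤ (ComplexPoints X) k}
    (ha : ∃ Z : Set X.left, IsClosed Z ∧ Z ≠ Set.univ ∧ ∃ N : ℕ, 1 ≤ N ∧ N • Res[X, Z, k] a = 0)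
    (hb : ∃ Z : Set X.left, IsClosed Z ∧ Z ≠ Set.univ ∧ ∃ N : ℕ, 1 ≤ N ∧ N • Res[X, Z, k] b = 0) :
    ∃ Z : Set X.left, IsClosed Z ∧ Z ≠ Set.univ ∧ ∃ N : ℕ, 1 ≤ N ∧ N • Res[X, Z, k] (a + b) = 0 := by
  obtain ⟨Z₁, hZ₁, hZ₁ne, N₁, hN₁, ha⟩ := ha
  obtain ⟨Z₂, hZ₂, hZ₂ne, N₂, hN₂, hb⟩ := hb
  refine ⟨Z₁ ∪ Z₂, hZ₁.union hZ₂, genericDivisibilityBounded_union_ne_univ hZ₁ hZ₂ hZ₁ne hZ₂ne,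
    N₁ * N₂, Nat.one_le_iff_ne_zero.2 (Nat.mul_ne_zero (by omega) (by omega)), ?_⟩
  have ha' : (N₁ * N₂) • Res[X, Z₁ ∪ Z₂, k] a = 0 := by
    rw [mul_comm, mul_smul, genericDivisibilityBounded_nsmul_restrict_mono Set.subset_union_left ha,
      smul_zero]
  have hb' : (N₁ * N₂) • Res[X, Z₁ ∪ Z₂, k] b = 0 := by
    rw [mul_smul, genericDivisibilityBounded_nsmul_restrict_mono Set.subset_union_right hb, smul_zero]
  rw [map_add, smul_add, ha', hb', add_zero]

/-- `GT` is closed under negation. [folklore] -/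
theorem genericDivisibilityBounded_genericallyTorsion_neg {X : SchemeOver ℂ} {k : ℕ}
    {a : singularCohomology ℤ ℤ (ComplexPoints X) k}
    (ha : ∃ Z : Set X.left, IsClosed Z ∧ Z ≠ Set.univ ∧ ∃ N : ℕ, 1 ≤ N ∧ N • Res[X, Z, k] a = 0) :
    ∃ Z : Set X.left, IsClosed Z ∧ Z ≠ Set.univ ∧ ∃ N : ℕ, 1 ≤ N ∧ N • Res[X, Z, k] (-a) = 0 := by
  obtain ⟨Z, hZ, hZne, N, hN, ha⟩ := ha
  exact ⟨Z, hZ, hZne, N, hN, by rw [map_neg, smul_neg, ha, neg_zero]⟩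

/-- `GT` is closed under `ℕ`-multiples. [folklore] -/
theorem genericDivisibilityBounded_genericallyTorsion_nsmul {X : SchemeOver ℂ} {k : ℕ}
    {a : singularCohomology ℤ ℤ (ComplexPoints X) k} (c : ℕ)
    (ha : ∃ Z : Set X.left, IsClosed Z ∧ Z ≠ Set.univ ∧ ∃ N : ℕ, 1 ≤ N ∧ N • Res[X, Z, k] a = 0) :
    ∃ Z : Set X.left, IsClosed Z ∧ Z ≠ Set.univ ∧ ∃ N : ℕ, 1 ≤ N ∧ N • Res[X, Z, k] (c • a) = 0 := by
  obtain ⟨Z, hZ, hZne, N, hN, ha⟩ := ha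
  exact ⟨Z, hZ, hZne, N, hN, by rw [map_nsmul, smul_comm, ha, smul_zero]⟩

/-- `GT` is SATURATED: `N • x ∈ GT`, `N ≥ 1 ⇒ x ∈ GT`. [folklore] -/
theorem genericDivisibilityBounded_genericallyTorsion_of_nsmul {X : SchemeOver ℂ} {k N : ℕ}
    (hN : 1 ≤ N) {x : singularCohomology ℤ ℤ (ComplexPoints X) k}
    (hx : ∃ Z : Set X.left, IsClosed Z ∧ Z ≠ Set.univ ∧ ∃ N' : ℕ, 1 ≤ N' ∧
      N' • Res[X, Z, k] (N • x) = 0) :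
    ∃ Z : Set X.left, IsClosed Z ∧ Z ≠ Set.univ ∧ ∃ N' : ℕ, 1 ≤ N' ∧ N' • Res[X, Z, k] x = 0 := by
  obtain ⟨Z, hZ, hZne, N', hN', h⟩ := hx
  refine ⟨Z, hZ, hZne, N' * N, Nat.one_le_iff_ne_zero.2 (Nat.mul_ne_zero (by omega) (by omega)), ?_⟩
  rwa [map_nsmul, ← mul_smul] at h

/-! ### The bootstrap: a clean level propagates up the `ℓ`-adic tower -/

/-- **Bootstrap (pure algebra, no Bloch–Kato).** If level `ℓ^s` is clean (`D'(ℓ^s, z) ⇒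
z ∈ ℓ H + GT` for all `z`) then `D'(ℓ^{n+s}, z) ⇒ z ∈ ℓ^{n+1} H + GT` for all `n`, `z`: induction on
`n` — on the intersection of the two opens `M N ℓ^{n+1} • (w₁| - ℓ^s y|) = 0`, i.e. `D'(ℓ^s, w₁)`,
and cleanness gives `w₁ ∈ ℓ H + GT`, whence `z ∈ ℓ^{n+2} H + GT`. [folklore] -/
theorem genericDivisibilityBounded_bootstrap {n₀ : ℕ} {X : SchemeOver ℂ}
    (hX : IsSmoothProjective n₀ X) (k ℓ s : ℕ) (hℓ : 1 ≤ ℓ)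
    (hclean : ∀ z : singularCohomology ℤ ℤ (ComplexPoints X) k,
      (∃ Z : Set X.left, IsClosed Z ∧ Z ≠ Set.univ ∧
        ∃ (y : singularCohomology ℤ ℤ (complexPointsCompl X Z) k) (M : ℕ), 1 ≤ M ∧
          M • (Res[X, Z, k] z - ℓ ^ s • y) = 0) →
      ∃ w : singularCohomology ℤ ℤ (ComplexPoints X) k, ∃ Z : Set X.left, IsClosed Z ∧
        Z ≠ Set.univ ∧ ∃ N : ℕ, 1 ≤ N ∧ N • Res[X, Z, k] (z - ℓ • w) = 0)
    (n : ℕ) (z : singularCohomology ℤ ℤ (ComplexPoints X) k)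
    (hz : ∃ Z : Set X.left, IsClosed Z ∧ Z ≠ Set.univ ∧
      ∃ (y : singularCohomology ℤ ℤ (complexPointsCompl X Z) k) (M : ℕ), 1 ≤ M ∧
        M • (Res[X, Z, k] z - ℓ ^ (n + s) • y) = 0) :
    ∃ w : singularCohomology ℤ ℤ (ComplexPoints X) k, ∃ Z : Set X.left, IsClosed Z ∧
      Z ≠ Set.univ ∧ ∃ N : ℕ, 1 ≤ N ∧ N • Res[X, Z, k] (z - ℓ ^ (n + 1) • w) = 0 := by
  haveI : IsIntegral X.left := IsSmoothProjective.isIntegral_holds hX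
  induction n generalizing z with
  | zero =>
    rw [Nat.zero_add] at hz
    obtain ⟨w, hw⟩ := hclean z hz
    exact ⟨w, by rwa [Nat.zero_add, pow_one]⟩
  | succ n ih =>
    obtain ⟨Z, hZ, hZne, y, M, hM, hMz⟩ := hz
    -- level `n + s` for `z`, with witness `ℓ • y`
    have hz' : ∃ Z : Set X.left, IsClosed Z ∧ Z ≠ Set.univ ∧
        ∃ (y : singularCohomology ℤ ℤ (complexPointsCompl X Z) k) (M : ℕ), 1 ≤ M ∧
          M • (Res[X, Z, k] z - ℓ ^ (n + s) • y) = 0 := by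
      refine ⟨Z, hZ, hZne, ℓ • y, M, hM, ?_⟩
      rw [← mul_smul, ← pow_succ, show n + s + 1 = n + 1 + s by omega]
      exact hMz
    obtain ⟨w₁, Z', hZ', hZ'ne, N, hN, hNw⟩ := ih z hz'
    -- transport both relations to the common open `X ∖ (Z ∪ Z')`
    have hA := congrArg (singularCohomology.map ℤ ℤ Incl[X, Z, Z ∪ Z', Set.subset_union_left] k) hMz
    rw [map_zero, map_nsmul, map_sub, map_nsmul] at hA
    change M • (singularCohomology.map ℤ ℤ _ k (singularCohomology.map ℤ ℤ _ k z) - _) = 0 at hA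
    rw [genericDivisibility_restrict_restrict ℤ Set.subset_union_left] at hA
    have hB : N • Res[X, Z ∪ Z', k] (z - ℓ ^ (n + 1) • w₁) = 0 :=
      genericDivisibilityBounded_nsmul_restrict_mono Set.subset_union_right hNw
    rw [map_sub, map_nsmul] at hB
    -- hence `D'(ℓ^s, w₁)` on `X ∖ (Z ∪ Z')` with multiplier `M N ℓ^{n+1}`
    have hw₁ : ∃ Z₀ : Set X.left, IsClosed Z₀ ∧ Z₀ ≠ Set.univ ∧
        ∃ (y₀ : singularCohomology ℤ ℤ (complexPointsCompl X Z₀) k) (M₀ : ℕ), 1 ≤ M₀ ∧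
          M₀ • (Res[X, Z₀, k] w₁ - ℓ ^ s • y₀) = 0 := by
      refine ⟨Z ∪ Z', hZ.union hZ', genericDivisibilityBounded_union_ne_univ hZ hZ' hZne hZ'ne,
        singularCohomology.map ℤ ℤ Incl[X, Z, Z ∪ Z', Set.subset_union_left] k y,
        M * N * ℓ ^ (n + 1),
        Nat.one_le_iff_ne_zero.2 (Nat.mul_ne_zero (Nat.mul_ne_zero (by omega) (by omega))
          (pow_ne_zero _ (by omega))), ?_⟩
      rw [pow_add] at hA
      have e : (M * N * ℓ ^ (n + 1)) • (Res[X, Z ∪ Z', k] w₁ -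
            ℓ ^ s • singularCohomology.map ℤ ℤ Incl[X, Z, Z ∪ Z', Set.subset_union_left] k y) =
          N • (M • (Res[X, Z ∪ Z', k] z - (ℓ ^ (n + 1) * ℓ ^ s) •
            singularCohomology.map ℤ ℤ Incl[X, Z, Z ∪ Z', Set.subset_union_left] k y)) -
          M • (N • (Res[X, Z ∪ Z', k] z - ℓ ^ (n + 1) • Res[X, Z ∪ Z', k] w₁)) := by
        module
      rw [e, hA, hB, smul_zero, smul_zero, sub_zero]
    obtain ⟨w₂, Z₂, hZ₂, hZ₂ne, N₂, hN₂, hw₂⟩ := hclean w₁ hw₁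
    refine ⟨w₂, ?_⟩
    have hsum : z - ℓ ^ (n + 1 + 1) • w₂ = (z - ℓ ^ (n + 1) • w₁) + ℓ ^ (n + 1) • (w₁ - ℓ • w₂) := by
      rw [pow_succ, mul_smul, smul_sub]
      abel
    rw [hsum]
    exact genericDivisibilityBounded_genericallyTorsion_add ⟨Z', hZ', hZ'ne, N, hN, hNw⟩
      (genericDivisibilityBounded_genericallyTorsion_nsmul _ ⟨Z₂, hZ₂, hZ₂ne, N₂, hN₂, hw₂⟩)

/-! ### Krull: a saturated subgroup of a finitely generated abelian group is `ℓ`-adically closed -/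

/-- In a finitely generated abelian group `M`, a SATURATED subgroup `S` (`N • x ∈ S`, `N ≥ 1 ⇒
x ∈ S`) is closed for the `ℓ`-adic topology, `ℓ ≥ 2`: if `z ≡ ℓ^{n+1} wₙ (mod S)` for every `n`
then `z ∈ S` (`M/S` is finitely generated and torsion-free; Krull's intersection theorem for the
proper ideal `(ℓ) ⊂ ℤ`, Mathlib `Ideal.iInf_pow_smul_eq_bot_of_isTorsionFree`). [folklore] -/
theorem genericDivisibilityBounded_krull {M : Type} [AddCommGroup M] [Module.Finite ℤ M]
    (S : AddSubgroup M) (hsat : ∀ (N : ℕ) (x : M), 1 ≤ N → N • x ∈ S → x ∈ S)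
    {ℓ : ℕ} (hℓ : 2 ≤ ℓ) {z : M} (hz : ∀ n : ℕ, ∃ w : M, z - ℓ ^ (n + 1) • w ∈ S) : z ∈ S := by
  let S' : Submodule ℤ M := AddSubgroup.toIntSubmodule S
  letI : Module ℤ (M ⧸ S') := Submodule.Quotient.module S'
  haveI : Module.Finite ℤ (M ⧸ S') := Module.Finite.quotient ℤ S'
  -- `M/S` is torsion-free because `S` is saturated
  haveI : Module.IsTorsionFree ℤ (M ⧸ S') := by
    refine Module.IsTorsionFree.of_smul_eq_zero fun c q hcq ↦ ?_
    by_cases hc : c = 0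
    · exact Or.inl hc
    · right
      induction q using Submodule.Quotient.induction_on with
      | H x =>
        rw [← Submodule.Quotient.mk_smul, Submodule.Quotient.mk_eq_zero] at hcq
        rw [Submodule.Quotient.mk_eq_zero]
        change c • x ∈ S at hcq
        change x ∈ S
        have hn : 1 ≤ c.natAbs := Nat.one_le_iff_ne_zero.2 (Int.natAbs_ne_zero.2 hc)
        refine hsat c.natAbs x hn ?_
        have h' : (c.natAbs : ℤ) • x ∈ S := by
          rw [← Int.sign_mul_self_eq_natAbs, mul_zsmul]
          exact S.zsmul_mem hcq _
        rwa [natCast_zsmul] at h'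
  let I : Ideal ℤ := Ideal.span {(ℓ : ℤ)}
  have hI : I ≠ ⊤ := by
    intro htop
    rw [Ideal.span_singleton_eq_top, Int.isUnit_iff] at htop
    omega
  have hq : Submodule.Quotient.mk (p := S') z ∈ (⨅ i : ℕ, I ^ i • ⊤ : Submodule ℤ (M ⧸ S')) := by
    refine (Submodule.mem_iInf _).2 fun i ↦ ?_
    obtain ⟨w, hw⟩ := hz i
    have hzw : Submodule.Quotient.mk (p := S') z =
        Submodule.Quotient.mk (p := S') (((ℓ : ℤ) ^ (i + 1)) • w) := by
      rw [eq_comm, ← sub_eq_zero, ← Submodule.Quotient.mk_sub, Submodule.Quotient.mk_eq_zero]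
      change (ℓ : ℤ) ^ (i + 1) • w - z ∈ S
      rw [← Int.natCast_pow, natCast_zsmul, ← neg_sub]
      exact S.neg_mem hw
    rw [hzw, Submodule.Quotient.mk_smul]
    refine Submodule.smul_mono_left (Ideal.pow_le_pow_right (Nat.le_succ i)) ?_
    exact Submodule.smul_mem_smul (Ideal.pow_mem_pow (Ideal.mem_span_singleton_self _) _)
      Submodule.mem_top
  rw [Ideal.iInf_pow_smul_eq_bot_of_isTorsionFree I hI, Submodule.mem_bot,
    Submodule.Quotient.mk_eq_zero] at hq
  exact hq

/-- The same for `GT ⊆ H^k(X(ℂ);ℤ)`, `X` smooth projective: `z ≡ ℓ^{n+1} wₙ (mod GT)` for all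
`n` (`ℓ ≥ 2`) forces `z ∈ GT` (`bettiCohomologyInt_finite_holds` + saturation of `GT`). [folklore] -/
theorem genericDivisibilityBounded_genericallyTorsion_of_forall_pow {n₀ : ℕ} {X : SchemeOver ℂ}
    (hX : IsSmoothProjective n₀ X) {k ℓ : ℕ} (hℓ : 2 ≤ ℓ) {z : singularCohomology ℤ ℤ (ComplexPoints X) k}
    (hz : ∀ n : ℕ, ∃ w : singularCohomology ℤ ℤ (ComplexPoints X) k, ∃ Z : Set X.left, IsClosed Z ∧
      Z ≠ Set.univ ∧ ∃ N : ℕ, 1 ≤ N ∧ N • Res[X, Z, k] (z - ℓ ^ (n + 1) • w) = 0) :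
    ∃ Z : Set X.left, IsClosed Z ∧ Z ≠ Set.univ ∧ ∃ N : ℕ, 1 ≤ N ∧ N • Res[X, Z, k] z = 0 := by
  haveI : IsIntegral X.left := IsSmoothProjective.isIntegral_holds hX
  -- finite generation, transported to the canonical `ℤ`-module structure
  haveI : @Module.Finite ℤ (singularCohomology ℤ ℤ (ComplexPoints X) k) _ _
      (AddCommGroup.toIntModule _) := by
    convert bettiCohomologyInt_finite_holds hX k
    exact Subsingleton.elim _ _
  let S : AddSubgroup (singularCohomology ℤ ℤ (ComplexPoints X) k) :=
    { carrier := {x | ∃ Z : Set X.left, IsClosed Z ∧ Z ≠ Set.univ ∧ ∃ N : ℕ, 1 ≤ N ∧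
        N • Res[X, Z, k] x = 0}
      add_mem' := fun ha hb ↦ genericDivisibilityBounded_genericallyTorsion_add ha hb
      zero_mem' := ⟨∅, isClosed_empty, fun h ↦ (Set.empty_ne_univ h).elim, 1, le_rfl,
        by rw [map_zero, smul_zero]⟩
      neg_mem' := fun ha ↦ genericDivisibilityBounded_genericallyTorsion_neg ha }
  have hS : z ∈ S :=
    genericDivisibilityBounded_krull S
      (fun N x hN hx ↦ genericDivisibilityBounded_genericallyTorsion_of_nsmul hN hx) hℓ
      (fun n ↦ by obtain ⟨w, hw⟩ := hz n; exact ⟨w, hw⟩)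
  exact hS

/-! ### The bridge `GT ⊗ ℂ ⊆ N¹` -/

/-- A generically-torsion integral class has complexification of coniveau `≥ 1`
(`supportedClasses X k 1`): change of coefficients commutes with restriction, `N` is invertible in
`ℂ`, and a proper closed subset of the integral scheme `X` has codimension `≥ 1` everywhere.
[cite: VoisinHodgeI2002, §11.3] -/
theorem genericDivisibilityBounded_ringChange_mem_supportedClasses {n₀ : ℕ} {X : SchemeOver ℂ}
    (hX : IsSmoothProjective n₀ X) {k : ℕ} {x : singularCohomology ℤ ℤ (ComplexPoints X) k}
    (hx : ∃ Z : Set X.left, IsClosed Z ∧ Z ≠ Set.univ ∧ ∃ N : ℕ, 1 ≤ N ∧ N • Res[X, Z, k] x = 0) :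
    singularCohomology.ringChange (Int.castRingHom ℂ) (ComplexPoints X) k x ∈
      supportedClasses X k 1 := by
  obtain ⟨Z, hZ, hZne, N, hN, h⟩ := hx
  haveI : IsIntegral X.left := IsSmoothProjective.isIntegral_holds hX
  refine mem_supportedClasses_of_restrictCompl_eq_zero hZ (fun z hz ↦ ?_) ?_
  · -- codimension ≥ 1: the generic point is not in the proper closed `Z`
    rw [Nat.cast_one, Order.one_le_iff_pos, Order.coheight_pos, not_isMax_iff]
    refine ⟨genericPoint X.left, lt_iff_le_not_ge.2 ⟨?_, fun hle ↦ hZne ?_⟩⟩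
    · exact Scheme.le_iff_specializes.2 (genericPoint_specializes z)
    · have h1 : genericPoint X.left ∈ Z :=
        hZ.closure_subset_iff.2 (Set.singleton_subset_iff.2 hz)
          (specializes_iff_mem_closure.1 (Scheme.le_iff_specializes.1 hle))
      have h2 : closure ({genericPoint X.left} : Set X.left) ⊆ Z :=
        hZ.closure_subset_iff.2 (Set.singleton_subset_iff.2 h1)
      rw [genericPoint_closure] at h2
      exact Set.eq_univ_of_univ_subset h2
  · -- `(x ⊗ ℂ)| = (x|) ⊗ ℂ` and `N • (x|) = 0` with `N ≠ 0` in `ℂ`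
    change singularCohomology.map ℂ ℂ _ k (singularCohomology.ringChange (Int.castRingHom ℂ) _ k x) = 0
    rw [← genericDivisibility_ringChange_map]
    have h' := congrArg (singularCohomology.ringChange (Int.castRingHom ℂ) (complexPointsCompl X Z) k) h
    rw [map_nsmul, map_zero, ← Nat.cast_smul_eq_nsmul ℂ, smul_eq_zero] at h'
    exact h'.resolve_left (Nat.cast_ne_zero.2 (by omega))

/-! ### C2 at `X` from one clean level at `X` -/

/-- **C2 at `X` from ONE clean level.** On a smooth projective `X`, if some prime `ℓ` has a clean
level `ℓ^s` (`s ≥ 1`) in degree `k`, then every `z ∈ H^k(X(ℂ);ℤ)` divisible by every `m ≥ 1` on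
the complex points of some non-empty Zariski open has complexification in `supportedClasses X k 1`:
`D'(ℓ^{n+s}, z)` for every `n`, bootstrap, Krull on the finitely generated `H/GT`, `GT ⊗ ℂ ⊆ N¹`
(the funnel of line `finite-level-bootstrap`, per variety and per degree). [folklore] -/
theorem genericDivisibilityBounded_at_of_levelClean {n₀ : ℕ} {X : SchemeOver ℂ}
    (hX : IsSmoothProjective n₀ X) (k : ℕ) {ℓ s : ℕ} (hℓ : ℓ.Prime) (hs : 1 ≤ s)
    (hclean : ∀ z : singularCohomology ℤ ℤ (ComplexPoints X) k,
      (∃ Z : Set X.left, IsClosed Z ∧ Z ≠ Set.univ ∧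
        ∃ (y : singularCohomology ℤ ℤ (complexPointsCompl X Z) k) (M : ℕ), 1 ≤ M ∧
          M • (Res[X, Z, k] z - ℓ ^ s • y) = 0) →
      ∃ w : singularCohomology ℤ ℤ (ComplexPoints X) k, ∃ Z : Set X.left, IsClosed Z ∧
        Z ≠ Set.univ ∧ ∃ N : ℕ, 1 ≤ N ∧ N • Res[X, Z, k] (z - ℓ • w) = 0)
    (z : singularCohomology ℤ ℤ (ComplexPoints X) k)
    (hz : ∀ m : ℕ, 1 ≤ m → ∃ Z : Set X.left, IsClosed Z ∧ Z ≠ Set.univ ∧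
      ∃ y : singularCohomology ℤ ℤ (complexPointsCompl X Z) k, m • y = Res[X, Z, k] z) :
    singularCohomology.ringChange (Int.castRingHom ℂ) (ComplexPoints X) k z ∈
      supportedClasses X k 1 := by
  have _ := hs
  have hall : ∀ n : ℕ, ∃ w : singularCohomology ℤ ℤ (ComplexPoints X) k, ∃ Z : Set X.left,
      IsClosed Z ∧ Z ≠ Set.univ ∧ ∃ N : ℕ, 1 ≤ N ∧ N • Res[X, Z, k] (z - ℓ ^ (n + 1) • w) = 0 := by
    intro n
    refine genericDivisibilityBounded_bootstrap hX k ℓ s hℓ.one_lt.le hclean n z ?_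
    obtain ⟨Z, hZ, hZne, y, hy⟩ := hz (ℓ ^ (n + s)) (Nat.one_le_pow _ _ hℓ.pos)
    exact ⟨Z, hZ, hZne, y, 1, le_rfl, by rw [one_smul, ← hy, sub_self]⟩
  exact genericDivisibilityBounded_ringChange_mem_supportedClasses hX
    (genericDivisibilityBounded_genericallyTorsion_of_forall_pow hX hℓ.two_le hall)

/-! ### The surface case: every prime is clean at level one, and C2 at `p = 1` -/

/-- **On a smooth projective surface every prime `ℓ` is clean at level one** (in fact for any
`ℓ ≥ 1`): from `M • (z| - ℓ • y) = 0` the class `(M ℓ) • y = (M • z)|` is global, so `y = w|` by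
the SATURATION of `im (H²(X(ℂ);ℤ) → H²((X∖Z)(ℂ);ℤ))` (landed stubs `stub_thomH3TorsionFreeNC`,
p145990, and `stub_surfaceSaturation_of_thomNC`, p146835: `H³` of the straightened pair is
torsion-free), and `M • (z - ℓ • w)| = 0` on the same open. Colliot-Thélène–Voisin 2012 §4.1 in
print (`0 → NS → H² → H²_nr → 0`). [cite: ColliotTheleneVoisin2012, §4.1] -/
theorem genericDivisibilityBounded_levelClean_surface {X : SchemeOver ℂ}
    (hX : IsSmoothProjective (2 * 1) X) {ℓ : ℕ} (hℓ : 1 ≤ ℓ)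
    (z : singularCohomology ℤ ℤ (ComplexPoints X) (2 * 1))
    (hz : ∃ Z : Set X.left, IsClosed Z ∧ Z ≠ Set.univ ∧
      ∃ (y : singularCohomology ℤ ℤ (complexPointsCompl X Z) (2 * 1)) (M : ℕ), 1 ≤ M ∧
        M • (Res[X, Z, 2 * 1] z - ℓ ^ 1 • y) = 0) :
    ∃ w : singularCohomology ℤ ℤ (ComplexPoints X) (2 * 1), ∃ Z : Set X.left, IsClosed Z ∧
      Z ≠ Set.univ ∧ ∃ N : ℕ, 1 ≤ N ∧ N • Res[X, Z, 2 * 1] (z - ℓ • w) = 0 := by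
  obtain ⟨Z, hZ, hZne, y, M, hM, hMz⟩ := hz
  rw [pow_one, smul_sub, sub_eq_zero, ← mul_smul] at hMz
  -- `(M ℓ) • y` is the restriction of the global class `M • z`
  obtain ⟨w, hw⟩ := stub_surfaceSaturation_of_thomNC
    (fun S hS hSc hdisj hflat hnc ↦ stub_thomH3TorsionFreeNC S hS hSc hdisj hflat hnc) hX Z hZ hZne
    y (M * ℓ) (Nat.one_le_iff_ne_zero.2 (Nat.mul_ne_zero (by omega) (by omega)))
    ⟨M • z, by rw [map_nsmul, hMz]⟩
  refine ⟨w, Z, hZ, hZne, M, hM, ?_⟩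
  rw [map_sub, map_nsmul, hw, smul_sub, ← mul_smul, hMz, sub_self]

/-- **The crux C2 at `p = 1` (surfaces, degree 2), PROVED — Hodge-free:** an integral class
`z ∈ H²(X(ℂ);ℤ)` on a smooth projective complex surface that is divisible by every `m ≥ 1` on the
complex points of some non-empty Zariski open has complexification of coniveau `≥ 1`. Level one is
clean at the prime `2` (`genericDivisibilityBounded_levelClean_surface`), then the funnel
`genericDivisibilityBounded_at_of_levelClean`. Colliot-Thélène–Voisin 2012 §4.1
(`H²(X;ℤ) ↠ H²_nr(X;ℤ) ≅ ℤ^{b₂-ρ}`) in the tree's vocabulary. [cite: ColliotTheleneVoisin2012, §4.1] -/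
theorem genericDivisibilityBounded_one :
    ∀ ⦃X : SchemeOver ℂ⦄, IsSmoothProjective (2 * 1) X →
      ∀ z : singularCohomology ℤ ℤ (ComplexPoints X) (2 * 1),
        (∀ m : ℕ, 1 ≤ m → ∃ Z : Set X.left, IsClosed Z ∧ Z ≠ Set.univ ∧
          ∃ y : singularCohomology ℤ ℤ (complexPointsCompl X Z) (2 * 1),
            m • y = Res[X, Z, 2 * 1] z) →
        singularCohomology.ringChange (Int.castRingHom ℂ) (ComplexPoints X) (2 * 1) z ∈
          supportedClasses X (2 * 1) 1 :=
  fun _ hX z hz ↦ genericDivisibilityBounded_at_of_levelClean hX (2 * 1) Nat.prime_two le_rfl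
    (fun z' hz' ↦ genericDivisibilityBounded_levelClean_surface hX (ℓ := 2) one_le_two z' hz') z hz

/-- **Registered sub-goal `stub_cruxAtOne` of stmt-HodgeConjecture-18467: the crux at `p = 1`**, i.e. the
route decl `GenericDivisibilityBounded` specialised to surfaces, verbatim (proof:
`genericDivisibilityBounded_one`). [cite: ColliotTheleneVoisin2012, §4.1] -/
theorem stub_cruxAtOne :
    ∀ ⦃X : SchemeOver ℂ⦄, IsSmoothProjective (2 * 1) X →
      ∀ z : singularCohomology ℤ ℤ (ComplexPoints X) (2 * 1),
        (∀ m : ℕ, 1 ≤ m → ∃ Z : Set X.left, IsClosed Z ∧ Z ≠ Set.univ ∧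
          ∃ y : singularCohomology ℤ ℤ (complexPointsCompl X Z) (2 * 1),
            m • y = singularCohomology.map ℤ ℤ
              (⟨Subtype.val, continuous_subtype_val⟩ : C(complexPointsCompl X Z, ComplexPoints X))
              (2 * 1) z) →
        singularCohomology.ringChange (Int.castRingHom ℂ) (ComplexPoints X) (2 * 1) z ∈
          supportedClasses X (2 * 1) 1 :=
  fun _ hX z hz ↦ genericDivisibilityBounded_one hX z hz


end Summit.HodgeConjecture.HodgeConjecture.Theorems

end
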